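import Summits.AtomisticToContinuum.Crystallization.Theorems.FrustratedLawDichotomyCellF1HostCol
import Summits.AtomisticToContinuum.Crystallization.Theorems.FrustratedLawDichotomyCellF1Lists
import Summits.AtomisticToContinuum.Crystallization.Theorems.FrustratedLawDichotomyCellArithClasses

/-!
# FrustratedLawDichotomy · crux `AperiodicFrustratedLawGap` (stmt-AtomisticToContinuum-27623) — class-A K-file skeleton, layer 5c:
the F1 ROOT-DEBIT column from hand-1's INTEGER reading `debHiZ` (decomp-a2c hand-2 g47, structural share; KFILE-FORMAT ed2 §1 «deb ≥
τ²snbW + erbW (`debHiZ`)», hand-1 `…CellArithClasses.deb_of_nearId_Z`; rule G5)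

The root-debit column of the K-number (`τ²·secondNeg ‖pos m‖ + energyRem ‖pos m‖ τ` over the debit list `ML = (ballL M zT ℓ_D 0).erase 0`) needs
NO table: hand-1's `debHiZ S lo hi rlo rhi τ` is a COMPUTABLE integer reading of rational window data, so the per-label reading `debK m :=
debHiZ 2⁴⁰ (loZ q) (hiZ q) (rloQF m) (rhiQF m) (1/1024)` (`q = qkF m`; brackets from layer 3d's window table) is evaluated by the kernel inside the
Floor file's one `decide`.  This file: the ℚ form of the layer-3d window facts (`pWin_soundQ`), the named column `debF1 m = debK m / 2⁴⁰`, ★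
`hdeb_F1` — for every `F` of the strain cell and every non-root label, `τ²·secondNeg + energyRem ≤ debF1 m` (hand-1's `deb_of_nearId_Z`, no
per-label arithmetic) —, and the list-sum identity `deb_sum_eq` turning `Σ_{m ∈ (ballL MF1 zT ℓ 0).erase 0} debF1 m` into an integer fold for any
debit radius `ℓ` (the dial `ℓ_D` stays free; `ℓ = 23` for `L_D = 3`).
-/

namespace Summit.AtomisticToContinuum.Crystallization.Theorems.FrustratedLawDichotomyCellF1Debit

open scoped BigOperators
open Summit.AtomisticToContinuum.Crystallization.Theorems.FrustratedLawDichotomyCellBST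
open Summit.AtomisticToContinuum.Crystallization.Theorems.FrustratedLawDichotomyCoherentFloorAlgebra (secondNeg energyRem)
open Summit.AtomisticToContinuum.Crystallization.Theorems.FrustratedLawDichotomyCellMetric (posL)
open Summit.AtomisticToContinuum.Crystallization.Theorems.FrustratedLawDichotomyCellClasses (ballL)
open Summit.AtomisticToContinuum.Crystallization.Theorems.FrustratedLawDichotomyCellTriples (zT)
open Summit.AtomisticToContinuum.Crystallization.Theorems.FrustratedLawDichotomyCellArithTaylor (debHiZ)
open Summit.AtomisticToContinuum.Crystallization.Theorems.FrustratedLawDichotomyCellArithClasses (deb_of_nearId_Z)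
open Summit.AtomisticToContinuum.Crystallization.Theorems.FrustratedLawDichotomyCellF1Labels (labF1 qkF qkF_eq MF1 mem_M mem_labF1)
open Summit.AtomisticToContinuum.Crystallization.Theorems.FrustratedLawDichotomyCellF1Lists (ballF1' ballF1'_nodup ballL_MF1_erase_eq)
open Summit.AtomisticToContinuum.Crystallization.Theorems.FrustratedLawDichotomyCellF1Pos (aF1)
open Summit.AtomisticToContinuum.Crystallization.Theorems.FrustratedLawDichotomyCellF1Windows (treeW pWin loN hiN window_MF1)
open Summit.AtomisticToContinuum.Crystallization.Theorems.FrustratedLawDichotomyCellF1ClassWin (loF1 hiF1 hloW_F1 hhiW_F1 qk_ne_zero_of_ne)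
open Summit.AtomisticToContinuum.Crystallization.Theorems.FrustratedLawDichotomyCellF1HostTable (loZ hiZ)
open Summit.AtomisticToContinuum.Crystallization.Theorems.FrustratedLawDichotomyCellF1HostCol (loZ_cast hiZ_cast)

/-- the scale of record `S = 2⁴⁰` for integer readings. -/
def SZ : ℤ := 1099511627776

/-- `0 < S`. -/
theorem SZ_pos : 0 < SZ := by unfold SZ; norm_num

/-- rational lower distance bracket of a label (layer 3d's numerator over `1024`). -/
def rloQF (m : ℤ × ℤ × ℤ) : ℚ := (loN (treeW.findD (qkF m) 0) : ℚ) / 1024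

/-- rational upper distance bracket of a label. -/
def rhiQF (m : ℤ × ℤ × ℤ) : ℚ := (hiN (treeW.findD (qkF m) 0) : ℚ) / 1024

/-- the ℚ form of the window leaf test (what hand-1's integer readings take as side conditions). -/
theorem pWin_soundQ {q c : ℤ} (h : pWin q c = true) :
    0 ≤ (loN c : ℚ) / 1024 ∧ ((loN c : ℚ) / 1024) ^ 2 ≤ loZ q ∧ hiZ q ≤ ((hiN c : ℚ) / 1024) ^ 2 ∧
      (q ≠ 0 → (1 / 1024 : ℚ) < (loN c : ℚ) / 1024) := by
  simp only [pWin, Bool.and_eq_true, Bool.or_eq_true, decide_eq_true_eq] at h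
  obtain ⟨⟨⟨h0, h1⟩, h2⟩, h3⟩ := h
  have h0' : (0 : ℚ) ≤ loN c := by exact_mod_cast h0
  have h1' : (loN c : ℚ) * loN c * 262144 ≤ 1021 * q := by exact_mod_cast h1
  have h2' : (1027 : ℚ) * q ≤ (hiN c : ℚ) * hiN c * 262144 := by exact_mod_cast h2
  refine ⟨by positivity, ?_, ?_, ?_⟩
  · unfold loZ; rw [div_pow]; nlinarith
  · unfold hiZ; rw [div_pow]; nlinarith
  · intro hq
    rcases h3 with h3 | h3
    · exact absurd h3 hq
    · have : (1 : ℚ) < loN c := by exact_mod_cast h3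
      rw [lt_div_iff₀ (by norm_num : (0 : ℚ) < 1024)]; linarith

/-- the integer debit reading of a label (hand-1's `debHiZ` at the label's class windows; kernel-computable). -/
def debK (m : ℤ × ℤ × ℤ) : ℤ := debHiZ SZ (loZ (qkF m)) (hiZ (qkF m)) (rloQF m) (rhiQF m) (1 / 1024)

/-- ★ the DEBIT COLUMN, NAMED (rule G5): `debF1 m = debK m / 2⁴⁰`. -/
noncomputable def debF1 (m : ℤ × ℤ × ℤ) : ℝ := (debK m : ℝ) / SZ

/-- ★ LABEL-WISE CERTIFICATION of the debit column: for every `F` of the strain cell and every non-root label, the root debit is below the reading. -/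
theorem hdeb_F1 {F : Matrix (Fin 3) (Fin 3) ℝ} (hG : ∀ i j, |(F.transpose * F) i j - (if i = j then 1 else 0)| ≤ 1 / 1024) :
    ∀ m ∈ MF1.erase 0, (1 / 1024 : ℝ) ^ 2 * secondNeg ‖posL F (aF1 m)‖ + energyRem ‖posL F (aF1 m)‖ (1 / 1024) ≤ debF1 m := by
  intro m hm
  obtain ⟨hm0, hmM⟩ := Finset.mem_erase.mp hm
  obtain ⟨hr0, hrlo2, hrhi2, hτr⟩ := pWin_soundQ (window_MF1 m hmM)
  have hq : qkF m ≠ 0 := by rw [qkF_eq]; exact qk_ne_zero_of_ne hm0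
  have hτr' := hτr hq
  have h0 : 0 < loZ (qkF m) := lt_of_lt_of_le (by positivity) hrlo2
  have hrhi : 0 ≤ (hiN (treeW.findD (qkF m) 0) : ℚ) / 1024 := by
    unfold Summit.AtomisticToContinuum.Crystallization.Theorems.FrustratedLawDichotomyCellF1Windows.hiN
    have : (0 : ℤ) ≤ treeW.findD (qkF m) 0 % 65536 := Int.emod_nonneg _ (by norm_num)
    positivity
  have hlo : ((loZ (qkF m) : ℚ) : ℝ) ≤ (1 - 3 * (1 / 1024 : ℝ)) * ∑ i, aF1 m i ^ 2 := by rw [loZ_cast]; exact hloW_F1 m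
  have hhi : (1 + 3 * (1 / 1024 : ℝ)) * ∑ i, aF1 m i ^ 2 ≤ ((hiZ (qkF m) : ℚ) : ℝ) := by rw [hiZ_cast]; exact hhiW_F1 m
  exact deb_of_nearId_Z (S := SZ) (ε := 1 / 1024) hG (aF1 m) (τ := 1 / 1024) (τq := 1 / 1024) (by norm_num) SZ_pos h0 hlo hhi hrlo2
    hrhi hrhi2 (by norm_num) hτr'

/-- ★ the debit SUM over the debit list of any radius `ℓ` is an integer fold (the Floor file's `decide` evaluates it). -/
theorem deb_sum_eq (ℓ : ℤ) : ∑ m ∈ (ballL MF1 zT ℓ (0 : ℤ × ℤ × ℤ)).erase 0, debF1 m = ((((ballF1' ℓ 0).map debK).sum : ℤ) : ℝ) / SZ := by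
  have hS : ∑ m ∈ (ballL MF1 zT ℓ (0 : ℤ × ℤ × ℤ)).erase 0, debF1 m
      = (∑ m ∈ (ballL MF1 zT ℓ (0 : ℤ × ℤ × ℤ)).erase 0, (debK m : ℝ)) / SZ := by
    rw [Finset.sum_div]; rfl
  rw [hS, ballL_MF1_erase_eq, List.sum_toFinset _ (ballF1'_nodup ℓ 0), Int.cast_list_sum, List.map_map]
  rfl

end Summit.AtomisticToContinuum.Crystallization.Theorems.FrustratedLawDichotomyCellF1Debit
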